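import Summits.Ventures.Crystal3D.Bulk.GapRhombus
import Literature.Geometry.DiscreteGeometry.KissingAngleBounds
import HarnessLib

/-!
# The linear rhombus rows R5 of the A-lineage angle LP in the kernel: `u ≤ 2τ` and
# `3τ ≤ u + v ≤ 2π − 2τ` (`τ = arccos (1/3)`) for a tight shell rhombus — FTTT13 Lemma 6 (5),(7)
# as CONSEQUENCES of the tree's exact relation `cot (u/2) cot (v/2) = 1/2`

HONEST FRAMING. Part of the venture `Summits/Ventures/Crystal3D` (cell `pub-crystal3d`, phase 2;
seat p2, PROMOTION-AUDIT prep). Kernel theorems about an ADMISSIBLE fourteen-ball configuration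
`c` (`IsGapConfig c`, no extremality) and elementary real analysis; nothing here asserts anything
about GAP(1.26), and no census number moves. Purpose: the A-family audit dossier
(`phase2/ENV-CENSUS/impla/audit-prep-g8/A-FAMILY-AUDIT-DOSSIER-engine4-g8.md` §2.2 row R5, §8
F-A4) records that the pass-1 LP `alp.py` (c1b00d37) imposes on every `60°`-rhombus face
`a b e d` of shell balls, besides "opposite corners equal" (kernel:
`IsGapConfig.corner_eq_corner_opposite`, `Bulk/GapRhombus.lean`), three LINEAR rows
`u ≤ 2τ`, `3τ ≤ u₀ + u₁`, `u₀ + u₁ ≤ 360° − 2τ` (`τ = arccos (1/3) = 70.5287793655…°`, coded with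
outward literals `TAU_LO = 70.5287793`, `TAU_HI = 70.5287794`), cited "FTTT13 Lemma 6 (4),(5),(7)
AS PRINTED", and asks whether they are KERNEL consequences of the tree's exact relation
`IsGapConfig.rhombus_corner_relation` (`(1 − cos u)(1 − cos v) = 4 (1 + cos u)(1 + cos v)`, i.e.
`cot (u/2) cot (v/2) = 1/2`) plus R-min (`arccos (1/3) ≤ corner`,
`IsGapConfig.arccos_third_le_corner`). THIS file answers yes:

* §1 (real analysis): for `u, v ∈ [0, π]` with the relation and `cos u, cos v ≤ 1/3`:
  `−7/9 ≤ cos u` (`neg_seven_ninths_le_cos_of_rhombusRel`); the half-angle law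
  `sin (u/2) sin (v/2) = 2 cos (u/2) cos (v/2)`, `cos (u/2 + v/2) = −cos (u/2) cos (v/2)`
  (`cos_half_add_half_of_rhombusRel`); and `3 arccos (1/3) ≤ u + v ≤ 2π − 2 arccos (1/3)`
  (`rhombusRel_sum_bounds`: with `A = cos² (u/2)`, `B = cos² (v/2)` one has `B (1 + 3A) = 1 − A`,
  `A, B ∈ [1/9, 2/3]`, so `2/27 ≤ AB ≤ 1/9`, i.e. `cos ((u+v)/2) ∈ [cos (π − τ), cos (3τ/2)]`);
  `u ≤ 2 arccos (1/3) = arccos (−7/9)` (`rhombusRel_le_two_mul_arccos_third`).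
* §2 (configurations): for every admissible `c` with `intruderDist c < 2` and every tight 4-cycle
  of shell balls `a b e d` (contacts `ab, be, ed, da`; `a ≠ e`, `b ≠ d`):
  **`IsGapConfig.rhombus_corner_le`** `corner c a b d ≤ 2 arccos (1/3)` (FTTT13 L6 (7));
  **`IsGapConfig.rhombus_corner_add_bounds`**
  `3 arccos (1/3) ≤ corner c a b d + corner c b a e ≤ 2π − 2 arccos (1/3)` (L6 (5) and the lower
  bound `u + v ≥ 3τ` which the PRINTED proof of (5) derives on p. 4 — alp uses it as a row; it is
  not a numbered item of the printed lemma); and the exact law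
  `IsGapConfig.cos_half_rhombus_corner_add`. No orientation / face / convexity hypothesis enters:
  the rows hold for the tangent-plane corners of ANY tight shell 4-cycle.

The numeric side (a 13-digit kernel bracket for `τ`, the rows in DEGREES with alp's literals) and
the R2/R4 cell envelopes are in `Bulk/GapCornerEnvelopes.lean`.

References: L. Flatley, A. Tarasov, M. Taylor, F. Theil, *Packing twelve spherical caps to
maximize tangencies*, J. Comput. Appl. Math. 254 (2013) 220–225, Lemma 6 and its proof (pp. 4–5
of the authors' manuscript) [`FlatleyEtAl2013`]; O. Musin, A. Tarasov, *The strong thirteen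
spheres problem*, DCG 48 (2012), Prop. 3.8 [`MusinTarasov2012`].
-/

noncomputable section

open scoped BigOperators InnerProductSpace
open Finset Real

namespace Summit.Ventures.Crystal3D

/-! ## §1 The adjacent-corner relation of the `60°`-rhombus: consequences in real analysis -/

section RhombusReal

/-- **From the rhombus relation and R-min at the adjacent corner, `cos u ≥ −7/9`.** If
`(1 − cos u)(1 − cos v) = 4 (1 + cos u)(1 + cos v)` and `cos v ≤ 1/3` then `−7/9 ≤ cos u`
(the relation solves to `cos v = −(3 + 5 cos u)/(5 + 3 cos u)`). [folklore] -/
theorem neg_seven_ninths_le_cos_of_rhombusRel {u v : ℝ}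
    (hrel : (1 - cos u) * (1 - cos v) = 4 * ((1 + cos u) * (1 + cos v)))
    (hcv : cos v ≤ 1 / 3) : -(7 / 9) ≤ cos u := by
  have hu := neg_one_le_cos u
  nlinarith [mul_nonneg (sub_nonneg.2 hcv) (by linarith : (0:ℝ) ≤ 5 + 3 * cos u)]

/-- **Half-angle law of the `60°`-rhombus.** For `u, v ∈ [0, π]` with
`(1 − cos u)(1 − cos v) = 4 (1 + cos u)(1 + cos v)`:
`sin (u/2) sin (v/2) = 2 cos (u/2) cos (v/2)` (i.e. `cot (u/2) cot (v/2) = 1/2`), hence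
`cos (u/2 + v/2) = −cos (u/2) cos (v/2)`. [folklore] -/
theorem cos_half_add_half_of_rhombusRel {u v : ℝ} (hu0 : 0 ≤ u) (huπ : u ≤ π) (hv0 : 0 ≤ v)
    (hvπ : v ≤ π) (hrel : (1 - cos u) * (1 - cos v) = 4 * ((1 + cos u) * (1 + cos v))) :
    sin (u / 2) * sin (v / 2) = 2 * (cos (u / 2) * cos (v / 2)) ∧
      cos (u / 2 + v / 2) = -(cos (u / 2) * cos (v / 2)) := by
  have hcu : 0 ≤ cos (u / 2) :=
    cos_nonneg_of_neg_pi_div_two_le_of_le (by linarith [pi_pos]) (by linarith)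
  have hcv : 0 ≤ cos (v / 2) :=
    cos_nonneg_of_neg_pi_div_two_le_of_le (by linarith [pi_pos]) (by linarith)
  have hsu : 0 ≤ sin (u / 2) := sin_nonneg_of_nonneg_of_le_pi (by linarith) (by linarith)
  have hsv : 0 ≤ sin (v / 2) := sin_nonneg_of_nonneg_of_le_pi (by linarith) (by linarith)
  have eu : cos u = 2 * cos (u / 2) ^ 2 - 1 := by
    have h := cos_two_mul (u / 2); rwa [show 2 * (u / 2) = u by ring] at h
  have ev : cos v = 2 * cos (v / 2) ^ 2 - 1 := by
    have h := cos_two_mul (v / 2); rwa [show 2 * (v / 2) = v by ring] at h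
  have su2 : sin (u / 2) ^ 2 = 1 - cos (u / 2) ^ 2 := sin_sq _
  have sv2 : sin (v / 2) ^ 2 = 1 - cos (v / 2) ^ 2 := sin_sq _
  have key : (sin (u / 2) * sin (v / 2)) ^ 2 = (2 * (cos (u / 2) * cos (v / 2))) ^ 2 := by
    rw [eu, ev] at hrel
    rw [mul_pow, mul_pow, su2, sv2]
    linear_combination (1 / 4 : ℝ) * hrel
  have hprod : sin (u / 2) * sin (v / 2) = 2 * (cos (u / 2) * cos (v / 2)) :=
    (pow_left_inj₀ (mul_nonneg hsu hsv) (by positivity) two_ne_zero).1 key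
  refine ⟨hprod, ?_⟩
  rw [cos_add, hprod]; ring

/-- `cos (arccos (1/3) / 2) = √(2/3)` and `cos (3 · (arccos (1/3) / 2)) = −√(2/3)/3`
(`cos 3θ = 4 cos³ θ − 3 cos θ`). [folklore] -/
theorem cos_three_half_arccos_third :
    cos (arccos (1 / 3) / 2) = √(2 / 3) ∧
      cos (3 * (arccos (1 / 3) / 2)) = -(√(2 / 3) / 3) := by
  have h0 := arccos_nonneg (1 / 3 : ℝ)
  have hπ := arccos_le_pi (1 / 3 : ℝ)
  have hc : cos (arccos (1 / 3) / 2) = √(2 / 3) := by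
    rw [cos_half (by linarith) hπ, cos_arccos (by norm_num) (by norm_num)]
    norm_num
  refine ⟨hc, ?_⟩
  rw [cos_three_mul, hc]
  have hs : (√(2 / 3) : ℝ) ^ 2 = 2 / 3 := Real.sq_sqrt (by norm_num)
  have : (√(2 / 3) : ℝ) ^ 3 = √(2 / 3) * (2 / 3) := by rw [pow_succ', hs]
  rw [this]; ring

/-- `3 · arccos (1/3) / 2 < π` (indeed `arccos (1/3) < 1.2311`). [folklore] -/
theorem three_mul_half_arccos_third_lt_pi : 3 * (arccos (1 / 3) / 2) < π := by
  have h := Literature.Geometry.DiscreteGeometry.arccos_third_lt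
  linarith [pi_gt_three]

/-- **The two-sided sum bound of the `60°`-rhombus** (FTTT13 Lemma 6 (5) form and the lower bound
from its printed proof). For `u, v ∈ [0, π]` with the rhombus relation and `cos u, cos v ≤ 1/3`:
`3 arccos (1/3) ≤ u + v ≤ 2π − 2 arccos (1/3)`. Proof: with `A = cos² (u/2)`, `B = cos² (v/2)`
one has `A, B ∈ [1/9, 2/3]`, `B (1 + 3A) = 1 − A`, hence `2/27 ≤ AB ≤ 1/9`, and
`cos ((u+v)/2) = −√(AB) ∈ [−1/3, −√(2/27)] = [cos (π − τ), cos (3τ/2)]`.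
[cite: FlatleyEtAl2013, Lemma 6 (5) and its proof] -/
theorem rhombusRel_sum_bounds {u v : ℝ} (hu0 : 0 ≤ u) (huπ : u ≤ π) (hv0 : 0 ≤ v) (hvπ : v ≤ π)
    (hrel : (1 - cos u) * (1 - cos v) = 4 * ((1 + cos u) * (1 + cos v)))
    (hcu : cos u ≤ 1 / 3) (hcv : cos v ≤ 1 / 3) :
    3 * arccos (1 / 3) ≤ u + v ∧ u + v ≤ 2 * π - 2 * arccos (1 / 3) := by
  have hcu' : -(7 / 9) ≤ cos u := neg_seven_ninths_le_cos_of_rhombusRel hrel hcv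
  have hcv' : -(7 / 9) ≤ cos v :=
    neg_seven_ninths_le_cos_of_rhombusRel (by linear_combination hrel) hcu
  obtain ⟨hprod, hcos⟩ := cos_half_add_half_of_rhombusRel hu0 huπ hv0 hvπ hrel
  set a := cos (u / 2) with ha
  set b := cos (v / 2) with hb
  have ha0 : 0 ≤ a := cos_nonneg_of_neg_pi_div_two_le_of_le (by linarith [pi_pos]) (by linarith)
  have hb0 : 0 ≤ b := cos_nonneg_of_neg_pi_div_two_le_of_le (by linarith [pi_pos]) (by linarith)
  have eu : cos u = 2 * a ^ 2 - 1 := by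
    have h := cos_two_mul (u / 2); rwa [show 2 * (u / 2) = u by ring] at h
  have ev : cos v = 2 * b ^ 2 - 1 := by
    have h := cos_two_mul (v / 2); rwa [show 2 * (v / 2) = v by ring] at h
  have hA1 : 1 / 9 ≤ a ^ 2 := by linarith
  have hA2 : a ^ 2 ≤ 2 / 3 := by linarith
  have hB1 : 1 / 9 ≤ b ^ 2 := by linarith
  -- the relation in `A = a², B = b²`: `B (1 + 3A) = 1 − A`
  have su2 : sin (u / 2) ^ 2 = 1 - a ^ 2 := sin_sq _
  have sv2 : sin (v / 2) ^ 2 = 1 - b ^ 2 := sin_sq _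
  have hrelAB : b ^ 2 * (1 + 3 * a ^ 2) = 1 - a ^ 2 := by
    have h := congrArg (fun t => t ^ 2) hprod
    simp only [mul_pow, su2, sv2] at h
    linear_combination (-1 : ℝ) * h
  have hpos : 0 < 1 + 3 * a ^ 2 := by positivity
  have hX : a ^ 2 * b ^ 2 * (1 + 3 * a ^ 2) = a ^ 2 * (1 - a ^ 2) := by
    rw [mul_assoc, hrelAB]
  have hPhi : a ^ 2 * b ^ 2 ≤ 1 / 9 := by nlinarith [sq_nonneg (3 * a ^ 2 - 1)]
  have hPlo : 2 / 27 ≤ a ^ 2 * b ^ 2 := by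
    nlinarith [mul_nonneg (sub_nonneg.2 hA1) (sub_nonneg.2 hA2)]
  have hab0 : 0 ≤ a * b := mul_nonneg ha0 hb0
  have hab_hi : a * b ≤ 1 / 3 := by nlinarith
  -- the angle `θ = (u+v)/2 ∈ [0, π]`, `cos θ = −ab`
  have hθ0 : 0 ≤ u / 2 + v / 2 := by linarith
  have hθπ : u / 2 + v / 2 ≤ π := by linarith
  constructor
  · -- lower bound: `cos θ ≤ cos (3τ/2) = −√(2/3)/3`
    obtain ⟨hc, hc3⟩ := cos_three_half_arccos_third
    have hk0 : 0 ≤ √(2 / 3) / 3 := by positivity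
    have hk2 : (√(2 / 3) / 3) ^ 2 = 2 / 27 := by
      rw [div_pow, Real.sq_sqrt (by norm_num)]; norm_num
    have hk_le : √(2 / 3) / 3 ≤ a * b := by
      apply (pow_le_pow_iff_left₀ hk0 hab0 two_ne_zero).1
      rw [hk2, mul_pow]; exact hPlo
    have hcos_le : cos (u / 2 + v / 2) ≤ cos (3 * (arccos (1 / 3) / 2)) := by
      rw [hcos, hc3]; linarith
    have h30 : 0 ≤ 3 * (arccos (1 / 3) / 2) := by
      have := arccos_nonneg (1 / 3 : ℝ); positivity
    have h3π := three_mul_half_arccos_third_lt_pi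
    have : 3 * (arccos (1 / 3) / 2) ≤ u / 2 + v / 2 := by
      rw [← arccos_cos h30 h3π.le, ← arccos_cos hθ0 hθπ]
      exact arccos_le_arccos hcos_le
    linarith
  · -- upper bound: `cos θ ≥ −1/3 = cos (π − τ)`
    have hcos_ge : -(1 / 3) ≤ cos (u / 2 + v / 2) := by rw [hcos]; linarith
    have : u / 2 + v / 2 ≤ arccos (-(1 / 3)) := by
      rw [← arccos_cos hθ0 hθπ]
      exact arccos_le_arccos hcos_ge
    rw [arccos_neg] at this
    linarith

/-- **Single-corner bound** (FTTT13 Lemma 6 (7) form): `u ≤ arccos (−7/9) = 2 arccos (1/3)` for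
`u ∈ [0, π]` with the rhombus relation and `cos v ≤ 1/3` at the adjacent corner.
[cite: FlatleyEtAl2013, Lemma 6 (7)] -/
theorem rhombusRel_le_two_mul_arccos_third {u v : ℝ} (hu0 : 0 ≤ u) (huπ : u ≤ π)
    (hrel : (1 - cos u) * (1 - cos v) = 4 * ((1 + cos u) * (1 + cos v)))
    (hcv : cos v ≤ 1 / 3) : u ≤ 2 * arccos (1 / 3) := by
  have h := neg_seven_ninths_le_cos_of_rhombusRel hrel hcv
  rw [← Literature.Geometry.DiscreteGeometry.arccos_neg_seven_ninths_eq, ← arccos_cos hu0 huπ]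
  exact arccos_le_arccos h

end RhombusReal

/-! ## §2 The R5 rows at a tight rhombus of shell balls -/

section ConfigRhombus

open Literature.Geometry.DiscreteGeometry InnerProductGeometry

variable {c : Fin 14 → EuclideanSpace ℝ (Fin 3)}

/-- A corner is an angle: `0 ≤ corner c i j k`. -/
theorem corner_nonneg (c : Fin 14 → EuclideanSpace ℝ (Fin 3)) (i j k : Fin 14) :
    0 ≤ corner c i j k :=
  angle_nonneg _ _

/-- R-min in cosine form: at a shell ball `i` touching shell balls `j ≠ k`, `cos (corner) ≤ 1/3`. -/
theorem IsGapConfig.cos_corner_le_third (hc : IsGapConfig c) {i j k : Fin 14} (hi0 : i ≠ 0)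
    (hi13 : i ≠ 13) (hj0 : j ≠ 0) (hj13 : j ≠ 13) (hk0 : k ≠ 0) (hk13 : k ≠ 13)
    (hij : dist (c i) (c j) = 1) (hik : dist (c i) (c k) = 1) (hjk : j ≠ k) :
    Real.cos (corner c i j k) ≤ 1 / 3 := by
  have h := hc.arccos_third_le_corner hi0 hi13 hj0 hj13 hk0 hk13 hij hik hjk
  have := cos_le_cos_of_nonneg_of_le_pi (arccos_nonneg _) (corner_le_pi c i j k) h
  rwa [cos_arccos (by norm_num) (by norm_num)] at this

/-- **R5, single corner (FTTT13 Lemma 6 (7)): every corner of a tight shell rhombus is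
`≤ 2τ = 2 arccos (1/3) = arccos (−7/9)` (`141.06°`).** For an admissible configuration with
`intruderDist c < 2` and shell balls `a, b, e, d` with contacts `ab, be, ed, da`, `a ≠ e`, `b ≠ d`:
`corner c a b d ≤ 2 arccos (1/3)`. [cite: FlatleyEtAl2013, Lemma 6 (7)] -/
theorem IsGapConfig.rhombus_corner_le (hc : IsGapConfig c) (hD : intruderDist c < 2)
    {a b e d : Fin 14} (ha0 : a ≠ 0) (ha13 : a ≠ 13) (hb0 : b ≠ 0) (hb13 : b ≠ 13)
    (he0 : e ≠ 0) (he13 : e ≠ 13) (hd0 : d ≠ 0) (hd13 : d ≠ 13) (hae : a ≠ e) (hbd : b ≠ d)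
    (hab : dist (c a) (c b) = 1) (hbe : dist (c b) (c e) = 1) (hed : dist (c e) (c d) = 1)
    (hda : dist (c d) (c a) = 1) :
    corner c a b d ≤ 2 * Real.arccos (1 / 3) := by
  have hrel := hc.rhombus_corner_relation hD ha0 ha13 hb0 hb13 he0 he13 hd0 hd13 hae hbd hab hbe
    hed hda
  have hba : dist (c b) (c a) = 1 := by rw [dist_comm]; exact hab
  have hcv := hc.cos_corner_le_third hb0 hb13 ha0 ha13 he0 he13 hba hbe hae
  exact rhombusRel_le_two_mul_arccos_third (corner_nonneg c a b d) (corner_le_pi c a b d) hrel hcv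

/-- **R5, adjacent corners (FTTT13 Lemma 6 (5) and the lower bound in its proof):
`3τ ≤ u_a + u_b ≤ 2π − 2τ`** (`211.59° ≤ u_a + u_b ≤ 218.94°`) for the adjacent corners
`u_a = corner c a b d`, `u_b = corner c b a e` of a tight shell rhombus `a b e d` (`a ≠ e`,
`b ≠ d`) of an admissible configuration with `intruderDist c < 2`.
[cite: FlatleyEtAl2013, Lemma 6 (5)] -/
theorem IsGapConfig.rhombus_corner_add_bounds (hc : IsGapConfig c) (hD : intruderDist c < 2)
    {a b e d : Fin 14} (ha0 : a ≠ 0) (ha13 : a ≠ 13) (hb0 : b ≠ 0) (hb13 : b ≠ 13)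
    (he0 : e ≠ 0) (he13 : e ≠ 13) (hd0 : d ≠ 0) (hd13 : d ≠ 13) (hae : a ≠ e) (hbd : b ≠ d)
    (hab : dist (c a) (c b) = 1) (hbe : dist (c b) (c e) = 1) (hed : dist (c e) (c d) = 1)
    (hda : dist (c d) (c a) = 1) :
    3 * Real.arccos (1 / 3) ≤ corner c a b d + corner c b a e ∧
      corner c a b d + corner c b a e ≤ 2 * π - 2 * Real.arccos (1 / 3) := by
  have hrel := hc.rhombus_corner_relation hD ha0 ha13 hb0 hb13 he0 he13 hd0 hd13 hae hbd hab hbe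
    hed hda
  have hba : dist (c b) (c a) = 1 := by rw [dist_comm]; exact hab
  have had : dist (c a) (c d) = 1 := by rw [dist_comm]; exact hda
  have hcu := hc.cos_corner_le_third ha0 ha13 hb0 hb13 hd0 hd13 hab had hbd
  have hcv := hc.cos_corner_le_third hb0 hb13 ha0 ha13 he0 he13 hba hbe hae
  exact rhombusRel_sum_bounds (corner_nonneg c a b d) (corner_le_pi c a b d)
    (corner_nonneg c b a e) (corner_le_pi c b a e) hrel hcu hcv

/-- **The exact adjacent-corner law behind R5**: `cos ((u_a + u_b)/2) = −cos (u_a/2) cos (u_b/2)`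
for the adjacent corners of a tight shell rhombus (equivalently `cot (u_a/2) cot (u_b/2) = 1/2`,
`IsGapConfig.rhombus_corner_relation`). -/
theorem IsGapConfig.cos_half_rhombus_corner_add (hc : IsGapConfig c) (hD : intruderDist c < 2)
    {a b e d : Fin 14} (ha0 : a ≠ 0) (ha13 : a ≠ 13) (hb0 : b ≠ 0) (hb13 : b ≠ 13)
    (he0 : e ≠ 0) (he13 : e ≠ 13) (hd0 : d ≠ 0) (hd13 : d ≠ 13) (hae : a ≠ e) (hbd : b ≠ d)
    (hab : dist (c a) (c b) = 1) (hbe : dist (c b) (c e) = 1) (hed : dist (c e) (c d) = 1)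
    (hda : dist (c d) (c a) = 1) :
    Real.cos ((corner c a b d + corner c b a e) / 2) =
      -(Real.cos (corner c a b d / 2) * Real.cos (corner c b a e / 2)) := by
  have hrel := hc.rhombus_corner_relation hD ha0 ha13 hb0 hb13 he0 he13 hd0 hd13 hae hbd hab hbe
    hed hda
  have h := (cos_half_add_half_of_rhombusRel (corner_nonneg c a b d) (corner_le_pi c a b d)
    (corner_nonneg c b a e) (corner_le_pi c b a e) hrel).2
  rw [add_div]; exact h

end ConfigRhombus

end Summit.Ventures.Crystal3D
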